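import Literature.NumberTheory.EllipticCurves.KubertTateFiveMuDescentNumberField
import Literature.NumberTheory.NumberFields.UnitRankZeroPowerClasses
import Mathlib.NumberTheory.NumberField.Completion.FinitePlace
import HarnessLib

/-!
# The `μ₅`-side of the `5`-descent on the Kubert–Tate family `E_{m,n}` over a number field `K`, II:
# `5 ∣ v(a)` for the Kummer invariant at every finite place `v ∤ mn`, and
# `#Sel^ψ(E'_{m,n}/ℚ(i)) ≤ 5^{#S}` for every set `S` of Gaussian primes supporting `mn`

PROOF-ONLY file (theorems only, no definition, no named fact, no `sorry`), topic
`NumberTheory/EllipticCurves`; sequel to `KubertTateFiveMuDescentNumberField` (§0–§1: the local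
condition of `Sel^ψ(E'/K)` at a `K`-field `L` read in `Lˣ/Lˣ⁵`), the base-field-generic form of §2–§3 of
the tree's `KubertTateFiveMuDescent` (`K = ℚ`, completions `ℚ_q`).  Setting: `E = E_{m,n}` over a number
field `K` (`m, n ∈ ℤ`), `φ : E → E'` Vélu's `5`-isogeny, `ψ : E' → E` with `ψ ∘ φ = [5]`, a `Γ_K`-fixed
`P₁ ∈ E(K̄)` with `25 P₁ ≠ O`; `v` a finite place of `K`, `K_v = v.adicCompletion K` its completion with
Mathlib's valuation `Valued.v : K_v → ℤᵐ⁰` (normalised, `v(K^×) = ℤ`).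

* §2 `valued_kummerFn_eq_pow` — at a place `v ∤ mn`, `v(f_T(x, y)) ∈ 5ℤ` for every `K_v`-point
  `(x, y) ≠ T` of `E` (the tree's valuation law `KubertTateKummer.exists_val_kummerFn_eq_pow` at the rank-one
  valuation `|·|_v = N v^{-v(·)}`); `five_dvd_log_valuation_of_kummer_local` — hence `5 ∣ v(a)` for the Kummer
  generator `a ∈ Kˣ` read through `kummer_local`; `five_dvd_log_valuation_of_generator`,
  **`five_dvd_log_valuation_of_mem_selmerGroup`** — **every representative `a ∈ Kˣ` of the Kummer invariant of a
  `ψ`-Selmer class has `5 ∣ v(a)` at every finite place `v` of `K` with `m, n ∉ v`.**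
* §3 (`K = ℚ(i) = ℚ(ζ₄)`) **`natCard_selmerGroup_dual_le_of_support`** — for every finite set `S` of finite
  places of `ℚ(i)` off which `m` and `n` are units, `#Sel^ψ(E'_{m,n}/ℚ(i)) ≤ 5 ^ #S`: the injective Kummer
  invariant followed by `a ↦ (v(a) mod 5)_{v ∈ S}` is injective, its kernel being `ℚ(i)(∅, 5) = 1`
  (tree `exists_eq_pow_of_forall_dvd_log_valuation_four`: `ℤ[i]` principal, unit rank `0`, `w = 4`).
  With the `ℤ/5`-side `KubertTateFiveSelmerTameGaussian` (`Sel^φ(E_{m,n}/ℚ(i)) = 0` in the Gaussian tame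
  régime) this is the complete `5`-isogeny descent of `E_{m,n}` over `ℚ(i)`, whose `5^∞`-Selmer group splits
  as `Sel(E_{m,n}/ℚ) ⊕ Sel(E_{m,n}^{(-1)}/ℚ)`: the door at `5` on the quadratic twists `E_{m,n}^{(-1)}`.

## References

* [SilvermanAEC2009] J. H. Silverman, *AEC*, 2nd ed., Thm. X.4.2, Prop. X.4.9, Exercise 10.1(c),
  Prop. VIII.1.6, Thm. X.1.1.
* [Fisher2001FiveSevenDescent] T. Fisher, JEMS 3 (2001), §§1–2.
* [Kubert1976] D. S. Kubert, *Universal bounds on the torsion of elliptic curves*, Table 3 (`N = 5`).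
-/

noncomputable section

open scoped Classical NNReal NumberField AddSubgroup
open WeierstrassCurve WeierstrassCurve.Isogeny Field IsDedekindDomain
open Literature.NumberTheory.EllipticCurves Literature.NumberTheory.EllipticCurves.KubertTateKummer
  Literature.NumberTheory.EllipticCurves.KubertTateVelu Literature.NumberTheory.GaloisRepresentations
  Literature.NumberTheory.NumberFields

namespace Literature.NumberTheory.EllipticCurves

namespace KubertTateMuDescentNF

variable {K : Type} [Field K] [NumberField K]
variable (m n : ℤ) [hE : (kubertTateFive (m : K) (n : K)).IsElliptic]
variable (ψ : Isogeny (kubertTateFive' (m : K) (n : K)) (kubertTateFive (m : K) (n : K)))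
  (hψ : ∀ P, ψ (fiveIsogeny (m : K) (n : K) P) = ((5 : ℕ) : ℤ) • P)
variable (P₁ : geomPoints (kubertTateFive (m : K) (n : K)))
  (hP₁ : ∀ σ : absoluteGaloisGroup K, σ • P₁ = P₁) (h25 : ((25 : ℕ) : ℤ) • P₁ ≠ 0)

/-! ## §2 At a finite place `v ∤ mn` of `K`: the valuation of the Kummer invariant is divisible by `5` -/

section Completion

variable (v : HeightOneSpectrum (𝓞 K))

omit hE in
/-- For an integer `z ∉ v`: `v(z) = 1` in `K_v`. [folklore] -/
private theorem valued_intCast_eq_one {z : ℤ} (hz : ((z : ℤ) : 𝓞 K) ∉ v.asIdeal) :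
    Valued.v ((z : ℤ) : v.adicCompletion K) = 1 := by
  have e : ((z : ℤ) : v.adicCompletion K) =
      algebraMap K (v.adicCompletion K) (algebraMap (𝓞 K) K (z : 𝓞 K)) := by
    rw [map_intCast, map_intCast]
  rw [e]
  change Valued.v (((algebraMap (𝓞 K) K (z : 𝓞 K) : K)) : v.adicCompletion K) = 1
  rw [HeightOneSpectrum.valuedAdicCompletion_eq_valuation', HeightOneSpectrum.valuation_of_algebraMap]
  exact le_antisymm (HeightOneSpectrum.intValuation_le_one v _)
    (not_lt.mp fun h ↦ hz ((HeightOneSpectrum.intValuation_lt_one_iff_mem v _).mp h))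

omit hE in
/-- **At `v ∤ mn`: `v(f_T(x, y)) ∈ 5ℤ`** for every `K_v`-point `(x, y) ≠ T` of `E_{m,n}` (the tree's valuation law
`KubertTateKummer.exists_val_kummerFn_eq_pow` at the rank-one valuation `N v^{-v(·)}` of `K_v`, `m, n` being
`v`-units). [cite: SilvermanAEC2009, Exercise 10.1(c)] -/
theorem valued_kummerFn_eq_pow (hvm : ((m : ℤ) : 𝓞 K) ∉ v.asIdeal) (hvn : ((n : ℤ) : 𝓞 K) ∉ v.asIdeal)
    {x y : v.adicCompletion K}
    (he : y ^ 2 + ((n : v.adicCompletion K) - m) * x * y - m * (n : v.adicCompletion K) ^ 2 * y =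
      x ^ 3 - m * n * x ^ 2) (hT : ¬ (x = 0 ∧ y = 0)) :
    x * y - n * x ^ 2 + (n : v.adicCompletion K) ^ 2 * y ≠ 0 ∧
      ∃ z : v.adicCompletion K, z ≠ 0 ∧
        Valued.v (x * y - n * x ^ 2 + (n : v.adicCompletion K) ^ 2 * y) = (Valued.v z) ^ 5 := by
  set τ := WithZeroMulInt.toNNReal (NumberField.HeightOneSpectrum.absNorm_ne_zero v) with hτ
  have hτmono : StrictMono τ :=
    WithZeroMulInt.toNNReal_strictMono (NumberField.HeightOneSpectrum.one_lt_absNorm_nnreal v)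
  set w : Valuation (v.adicCompletion K) ℝ≥0 :=
    (Valued.v : Valuation (v.adicCompletion K) (WithZero (Multiplicative ℤ))).map τ hτmono.monotone with hw
  have hw_apply : ∀ t : v.adicCompletion K, w t = τ (Valued.v t) := fun t ↦ rfl
  have hint : ∀ {z : ℤ}, ((z : ℤ) : 𝓞 K) ∉ v.asIdeal → w (z : v.adicCompletion K) = 1 := fun {z} hz ↦ by
    rw [hw_apply, valued_intCast_eq_one v hz, map_one]
  obtain ⟨z, hz0, hz⟩ := KubertTateKummer.exists_val_kummerFn_eq_pow w (hint hvm) (hint hvn) he hT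
  have hF0 : x * y - n * x ^ 2 + (n : v.adicCompletion K) ^ 2 * y ≠ 0 := by
    intro h0
    rw [h0, map_zero, eq_comm, pow_eq_zero_iff (by norm_num : 5 ≠ 0), map_eq_zero] at hz
    exact hz0 hz
  refine ⟨hF0, z, hz0, hτmono.injective ?_⟩
  rw [map_pow, ← hw_apply, ← hw_apply, hz]

omit hE in
/-- **`5 ∣ v(a)` from the local reading at `K_v`**, `v ∤ mn`: if `(ιa)ᵏ = u⁵`, or
`(ιa)ᵏ u⁵ ι f_T(x₀, y₀) = f_T(x, y)` at a `K_v`-point `(x, y) ≠ T` and a `K`-point `(x₀, y₀) ≠ T` of `E`, with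
`5 ∤ k` (all Kummer values have valuation in `5ℤ`). [cite: SilvermanAEC2009, Exercise 10.1(c)]
[cite: Fisher2001FiveSevenDescent, §2] -/
theorem five_dvd_log_valuation_of_kummer_local (hvm : ((m : ℤ) : 𝓞 K) ∉ v.asIdeal)
    (hvn : ((n : ℤ) : 𝓞 K) ∉ v.asIdeal) {a : K} (ha : a ≠ 0)
    {k : ℕ} {u x y : v.adicCompletion K} {x₀ y₀ : K} (hk : ¬ 5 ∣ k) (hu : u ≠ 0)
    (h : (algebraMap K (v.adicCompletion K) a) ^ k = u ^ 5 ∨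
      ((y ^ 2 + ((n : v.adicCompletion K) - m) * x * y - m * (n : v.adicCompletion K) ^ 2 * y =
          x ^ 3 - m * n * x ^ 2 ∧ ¬ (x = 0 ∧ y = 0)) ∧
       (y₀ ^ 2 + ((n : K) - m) * x₀ * y₀ - m * (n : K) ^ 2 * y₀ = x₀ ^ 3 - m * n * x₀ ^ 2 ∧ ¬ (x₀ = 0 ∧ y₀ = 0)) ∧
        (algebraMap K (v.adicCompletion K) a) ^ k * u ^ 5 *
            algebraMap K (v.adicCompletion K) (x₀ * y₀ - n * x₀ ^ 2 + (n : K) ^ 2 * y₀) =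
          x * y - n * x ^ 2 + (n : v.adicCompletion K) ^ 2 * y)) :
    (5 : ℤ) ∣ WithZero.log (v.valuation K a) := by
  have haL : Valued.v (algebraMap K (v.adicCompletion K) a) = v.valuation K a := by
    change Valued.v ((a : K) : v.adicCompletion K) = _
    exact HeightOneSpectrum.valuedAdicCompletion_eq_valuation' v a
  have hva : v.valuation K a ≠ 0 := (Valuation.ne_zero_iff _).mpr ha
  have hvaL : Valued.v (algebraMap K (v.adicCompletion K) a) ≠ 0 := by rw [haL]; exact hva
  have hvu : Valued.v u ≠ 0 := (Valuation.ne_zero_iff _).mpr hu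
  have hcop : IsCoprime (5 : ℤ) (k : ℤ) := by
    have h5 : IsCoprime ((5 : ℕ) : ℤ) (k : ℤ) :=
      Nat.isCoprime_iff_coprime.mpr ((Nat.Prime.coprime_iff_not_dvd Nat.prime_five).mpr hk)
    exact_mod_cast h5
  -- `5 ∣ k · v(a)` suffices
  suffices hkv : (5 : ℤ) ∣ (k : ℤ) * WithZero.log (v.valuation K a) by
    rw [mul_comm] at hkv
    exact hcop.dvd_of_dvd_mul_right hkv
  have hlogk : WithZero.log (Valued.v ((algebraMap K (v.adicCompletion K) a) ^ k)) = (k : ℤ) * WithZero.log (v.valuation K a) := by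
    rw [map_pow, WithZero.log_pow, haL, nsmul_eq_mul]
  rcases h with h | ⟨⟨he, hT⟩, ⟨he₀, hT₀⟩, h⟩
  · rw [← hlogk, h, map_pow, WithZero.log_pow, nsmul_eq_mul]
    exact ⟨WithZero.log (Valued.v u), rfl⟩
  · obtain ⟨hF0, z, hz0, hval⟩ := valued_kummerFn_eq_pow m n v hvm hvn he hT
    -- the `K`-point `(x₀, y₀)` read in `K_v`
    have he₀' : (algebraMap K (v.adicCompletion K) y₀) ^ 2 + ((n : v.adicCompletion K) - m) * algebraMap K (v.adicCompletion K) x₀ * algebraMap K (v.adicCompletion K) y₀ -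
        m * (n : v.adicCompletion K) ^ 2 * algebraMap K (v.adicCompletion K) y₀ = (algebraMap K (v.adicCompletion K) x₀) ^ 3 - m * n * (algebraMap K (v.adicCompletion K) x₀) ^ 2 := by
      have := congrArg (algebraMap K (v.adicCompletion K)) he₀
      simpa [map_sub, map_add, map_mul, map_pow, map_intCast] using this
    have hT₀' : ¬ (algebraMap K (v.adicCompletion K) x₀ = 0 ∧ algebraMap K (v.adicCompletion K) y₀ = 0) := by
      rintro ⟨hx, hy⟩
      exact hT₀ ⟨(map_eq_zero _).mp hx, (map_eq_zero _).mp hy⟩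
    obtain ⟨hF₀0, z₀, hz₀0, hval₀⟩ := valued_kummerFn_eq_pow m n v hvm hvn he₀' hT₀'
    have eF₀ : algebraMap K (v.adicCompletion K) (x₀ * y₀ - n * x₀ ^ 2 + (n : K) ^ 2 * y₀) =
        algebraMap K (v.adicCompletion K) x₀ * algebraMap K (v.adicCompletion K) y₀ - n * (algebraMap K (v.adicCompletion K) x₀) ^ 2 + (n : v.adicCompletion K) ^ 2 * algebraMap K (v.adicCompletion K) y₀ := by
      simp [map_sub, map_add, map_mul, map_pow, map_intCast]
    rw [eF₀] at h
    have hvz : Valued.v z ≠ 0 := (Valuation.ne_zero_iff _).mpr hz0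
    have hvz₀ : Valued.v z₀ ≠ 0 := (Valuation.ne_zero_iff _).mpr hz₀0
    have hlog : WithZero.log (Valued.v ((algebraMap K (v.adicCompletion K) a) ^ k * u ^ 5 *
        (algebraMap K (v.adicCompletion K) x₀ * algebraMap K (v.adicCompletion K) y₀ -
          n * (algebraMap K (v.adicCompletion K) x₀) ^ 2 +
          (n : v.adicCompletion K) ^ 2 * algebraMap K (v.adicCompletion K) y₀))) =
        WithZero.log (Valued.v (x * y - n * x ^ 2 + (n : v.adicCompletion K) ^ 2 * y)) := by rw [h]
    rw [map_mul, map_mul, map_pow, map_pow, hval₀, hval] at hlog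
    rw [WithZero.log_mul (mul_ne_zero (pow_ne_zero _ hvaL) (pow_ne_zero _ hvu)) (pow_ne_zero _ hvz₀),
      WithZero.log_mul (pow_ne_zero _ hvaL) (pow_ne_zero _ hvu), WithZero.log_pow, WithZero.log_pow,
      WithZero.log_pow, WithZero.log_pow, haL] at hlog
    simp only [nsmul_eq_mul] at hlog
    exact ⟨WithZero.log (Valued.v z) - WithZero.log (Valued.v u) - WithZero.log (Valued.v z₀), by
      push_cast at hlog ⊢; linarith⟩

include hP₁ h25 in
/-- **`5 ∣ v(a)` for every finite place `v ∤ mn`** when `(α, a)` is a Kummer generator of a cocycle `c` whose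
class lies in the `ψ`-Selmer group (local condition at `v` read at `K_v` by `kummer_local`, then
`five_dvd_log_valuation_of_kummer_local`). [cite: SilvermanAEC2009, Thm. X.4.2 and Prop. X.4.9]
[cite: Fisher2001FiveSevenDescent, §2] -/
theorem five_dvd_log_valuation_of_generator
    (c : letI := ψ.kerAction
      contOneCocycles (discreteTopRep (absoluteGaloisGroup K) ψ.toAddMonoidHom.ker))
    (hsel : letI := ψ.kerAction
      oneCocycleClass _ c ∈ ψ.selmerGroup)
    {α : (AlgebraicClosure K)ˣ} {a : Kˣ}
    (hαp : α ^ 5 = Units.map (algebraMap K (AlgebraicClosure K) : K →* AlgebraicClosure K) a)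
    (hcα : ∀ σ : absoluteGaloisGroup K, muVal K 5 (dualKerChar (fiveIsogeny (m : K) (n : K)) ψ hψ (Tbar (m : K) (n : K))
      (five_zsmul_Tbar (m : K) (n : K)) (ker_fiveIsogeny_eq_zmultiples (m : K) (n : K)) (c.1 σ)) = σ • α / α)
    (hvm : ((m : ℤ) : 𝓞 K) ∉ v.asIdeal) (hvn : ((n : ℤ) : 𝓞 K) ∉ v.asIdeal) :
    (5 : ℤ) ∣ WithZero.log (v.valuation K (a : K)) := by
  letI := ψ.kerAction
  haveI : CharZero (v.adicCompletion K) :=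
    charZero_of_injective_algebraMap (algebraMap K (v.adicCompletion K)).injective
  have hloc := ((ψ.mem_selmerGroup_iff _).mp hsel).1 v
  obtain ⟨k, u, x, y, x₀, y₀, hk, hu, h⟩ :=
    kummer_local m n ψ hψ P₁ hP₁ h25 (v.adicCompletion K) c hloc hαp hcα
  exact five_dvd_log_valuation_of_kummer_local m n v hvm hvn (a := (a : K)) a.ne_zero hk hu h

include hP₁ h25 in
/-- **Every representative `a ∈ Kˣ` of the Kummer invariant of a `ψ`-Selmer class has `5 ∣ v(a)` for all
finite places `v` of `K` with `m, n ∉ v`.** [cite: SilvermanAEC2009, Thm. X.4.2 and Prop. X.4.9]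
[cite: Fisher2001FiveSevenDescent, §2] -/
theorem five_dvd_log_valuation_of_mem_selmerGroup {ξ : ψ.galH1Ker} (hξ : ξ ∈ ψ.selmerGroup) {a : Kˣ}
    (ha : kummerInvariant (fiveIsogeny (m : K) (n : K)) ψ hψ (Tbar (m : K) (n : K)) (five_zsmul_Tbar (m : K) (n : K))
      (smul_Tbar (m : K) (n : K)) (ker_fiveIsogeny_eq_zmultiples (m : K) (n : K)) ξ = Additive.ofMul (QuotientGroup.mk a))
    (hvm : ((m : ℤ) : 𝓞 K) ∉ v.asIdeal) (hvn : ((n : ℤ) : 𝓞 K) ∉ v.asIdeal) :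
    (5 : ℤ) ∣ WithZero.log (v.valuation K (a : K)) := by
  letI := ψ.kerAction
  obtain ⟨c, rfl⟩ := oneCocycleClass_surjective _ ξ
  obtain ⟨α, a₀, hαp, hcα⟩ := exists_root_of_cocycle (fiveIsogeny (m : K) (n : K)) ψ hψ (Tbar (m : K) (n : K))
    (five_zsmul_Tbar (m : K) (n : K)) (smul_Tbar (m : K) (n : K)) (ker_fiveIsogeny_eq_zmultiples (m : K) (n : K)) c
  have h0 := five_dvd_log_valuation_of_generator m n ψ hψ P₁ hP₁ h25 v c hξ hαp hcα hvm hvn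
  -- `a ≡ a₀ (mod Kˣ⁵)`
  have hinv := kummerInvariant_oneCocycleClass_eq_of_root (fiveIsogeny (m : K) (n : K)) ψ hψ (Tbar (m : K) (n : K))
    (five_zsmul_Tbar (m : K) (n : K)) (smul_Tbar (m : K) (n : K)) (ker_fiveIsogeny_eq_zmultiples (m : K) (n : K)) c hαp hcα
  rw [ha] at hinv
  have hq' : (QuotientGroup.mk a : Kˣ ⧸ (powMonoidHom 5 : Kˣ →* Kˣ).range) = QuotientGroup.mk a₀ :=
    Additive.ofMul.injective hinv
  rw [QuotientGroup.eq] at hq'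
  obtain ⟨w, hw⟩ := hq'
  have haw : (a₀ : K) = a * (w : K) ^ 5 := by
    have := congrArg (fun z : Kˣ ↦ (z : K)) hw
    simp only [powMonoidHom_apply, Units.val_mul, Units.val_pow_eq_pow_val, Units.val_inv_eq_inv_val] at this
    field_simp at this
    linear_combination -this
  have hva : v.valuation K (a : K) ≠ 0 := (Valuation.ne_zero_iff _).mpr a.ne_zero
  have hvw : v.valuation K (w : K) ≠ 0 := (Valuation.ne_zero_iff _).mpr w.ne_zero
  have hv : WithZero.log (v.valuation K (a₀ : K)) =
      WithZero.log (v.valuation K (a : K)) + 5 * WithZero.log (v.valuation K (w : K)) := by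
    rw [haw, map_mul, map_pow, WithZero.log_mul hva (pow_ne_zero _ hvw), WithZero.log_pow, nsmul_eq_mul]
    push_cast; ring
  obtain ⟨r, hr⟩ := h0
  exact ⟨r - WithZero.log (v.valuation K (w : K)), by linarith⟩

end Completion

/-! ## §3 Over `ℚ(i)`: `#Sel^ψ(E'/ℚ(i)) ≤ 5 ^ #S` for every finite set `S` of places supporting `mn` -/

include hψ hP₁ h25 in
/-- **`#Sel^ψ(E'_{m,n}/ℚ(i)) ≤ 5 ^ #S`** for every finite set `S` of finite places of `ℚ(i)` off which `m` and `n`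
are units (e.g. the set of Gaussian primes dividing `mn`).  The injective Kummer invariant
(`kummerInvariant_injective`) followed by `a ↦ (v(a) mod 5)_{v ∈ S}` is injective on the Selmer group: two Selmer
classes with the same exponents on `S` differ by a class `a ∈ ℚ(i)ˣ` with `5 ∣ v(a)` at EVERY finite place,
i.e. a fifth power (`ℚ(i)(∅, 5) = 1`: `ℤ[i]` principal, units `±1, ±i`; tree
`exists_eq_pow_of_forall_dvd_log_valuation_four`). [cite: SilvermanAEC2009, Prop. X.4.9, Prop. VIII.1.6 and
Exercise 10.1(c)] [cite: Fisher2001FiveSevenDescent, §2] -/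
theorem natCard_selmerGroup_dual_le_of_support [IsCyclotomicExtension {4} ℚ K]
    (S : Finset (HeightOneSpectrum (𝓞 K)))
    (hS : ∀ v : HeightOneSpectrum (𝓞 K), v ∉ S → ((m : ℤ) : 𝓞 K) ∉ v.asIdeal ∧ ((n : ℤ) : 𝓞 K) ∉ v.asIdeal) :
    Nat.card ψ.selmerGroup ≤ 5 ^ S.card := by
  letI := ψ.kerAction
  set Κ := kummerInvariant (fiveIsogeny (m : K) (n : K)) ψ hψ (Tbar (m : K) (n : K)) (five_zsmul_Tbar (m : K) (n : K))
    (smul_Tbar (m : K) (n : K)) (ker_fiveIsogeny_eq_zmultiples (m : K) (n : K)) with hΚ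
  have hΚinj : Function.Injective Κ := kummerInvariant_injective _ _ _ _ _ (Tbar_ne_zero (m : K) (n : K)) _ _
  -- a representative in `Kˣ` of the invariant of each class
  have hrep : ∀ ξ : ψ.galH1Ker, ∃ a : Kˣ, Κ ξ = Additive.ofMul (QuotientGroup.mk a) := fun ξ ↦ by
    obtain ⟨a, ha⟩ := QuotientGroup.mk_surjective (Additive.toMul (Κ ξ))
    exact ⟨a, by rw [ha]; rfl⟩
  choose rep hrep using hrep
  let g : ψ.selmerGroup → (S → ZMod 5) := fun ξ v ↦
    (((WithZero.log (v.1.valuation K (rep ξ : K)) : ℤ) : ZMod 5))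
  have hg : Function.Injective g := by
    intro ξ ξ' hgg
    -- the quotient `a/a'` represents `Κ (ξ - ξ')`
    have hdiff : Κ ((ξ : ψ.galH1Ker) - ξ') = Additive.ofMul (QuotientGroup.mk (rep ξ / rep ξ')) := by
      rw [map_sub, hrep, hrep, QuotientGroup.mk_div, ofMul_div]
    have hmem : ((ξ : ψ.galH1Ker) - ξ') ∈ ψ.selmerGroup := ψ.selmerGroup.sub_mem ξ.2 ξ'.2
    have hall : ∀ v : HeightOneSpectrum (𝓞 K),
        (5 : ℤ) ∣ WithZero.log (v.valuation K ((rep ξ / rep ξ' : Kˣ) : K)) := by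
      intro v
      have hdiv : ((rep ξ / rep ξ' : Kˣ) : K) = (rep ξ : K) / (rep ξ' : K) := Units.val_div_eq_div_val _ _
      by_cases hvS : v ∈ S
      · have hv' := congrFun hgg ⟨v, hvS⟩
        simp only [g] at hv'
        have hva : v.valuation K (rep ξ : K) ≠ 0 := (Valuation.ne_zero_iff _).mpr (rep ξ).ne_zero
        have hva' : v.valuation K (rep ξ' : K) ≠ 0 := (Valuation.ne_zero_iff _).mpr (rep ξ').ne_zero
        rw [hdiv, map_div₀, WithZero.log_div hva hva']
        exact (ZMod.intCast_eq_intCast_iff_dvd_sub _ _ 5).mp hv'.symm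
      · obtain ⟨hvm, hvn⟩ := hS v hvS
        exact five_dvd_log_valuation_of_mem_selmerGroup m n ψ hψ P₁ hP₁ h25 v hmem hdiff hvm hvn
    obtain ⟨w, hw⟩ := exists_eq_pow_of_forall_dvd_log_valuation_four (n := 5) (by decide)
      (rep ξ / rep ξ').ne_zero hall
    have hw0 : w ≠ 0 := by
      intro h0
      rw [h0, zero_pow (by norm_num)] at hw
      exact (rep ξ / rep ξ').ne_zero hw
    have h1 : (QuotientGroup.mk (rep ξ / rep ξ') : Kˣ ⧸ (powMonoidHom 5 : Kˣ →* Kˣ).range) = 1 := by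
      rw [QuotientGroup.eq_one_iff]
      exact ⟨Units.mk0 w hw0, Units.ext (by rw [powMonoidHom_apply, Units.val_pow_eq_pow_val, Units.val_mk0, ← hw])⟩
    rw [h1, ofMul_one] at hdiff
    have h0 : (ξ : ψ.galH1Ker) - ξ' = 0 := hΚinj (by rw [hdiff, map_zero])
    exact Subtype.ext (sub_eq_zero.mp h0)
  have hcard := Nat.card_le_card_of_injective g hg
  have hfun : Nat.card (S → ZMod 5) = 5 ^ S.card := by
    rw [Nat.card_fun, Nat.card_eq_fintype_card (α := ZMod 5), ZMod.card, Nat.card_eq_fintype_card,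
      Fintype.card_coe]
  rw [hfun] at hcard
  exact hcard

end KubertTateMuDescentNF

end Literature.NumberTheory.EllipticCurves

end
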